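import Literature.NumberTheory.EllipticCurves.KimNakamura2020.NonExceptionalFiveTorsionProofs
import Literature.NumberTheory.EllipticCurves.LocalTorsionAdditiveReductionPPrimaryProofs
import Literature.NumberTheory.EllipticCurves.MazurTorsionLocalStepsProofs
import Literature.NumberTheory.EllipticCurves.VariableChangePointsMap
import HarnessLib

/-!
# `E(ℚ₅)[5] = 0` at an ADDITIVE prime `5` off the Kosters–Pannekoek exceptional class
# `a₄ ≡ 10 (mod 25)` (Kim, *AJM* 148 (2026), Prop. 3.2; Kosters–Pannekoek, Cor. 2) — kernel form on
# a globally minimal (2.1)-model, and on any globally minimal `W/ℚ` through an integral translate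

Sources: C.-H. Kim, Amer. J. Math. 148 (2026) = arXiv:2203.12159 [Kim2022StructureSelmer], §3.1 and
Prop. 3.2 (PDF p. 15): for `E/ℚ` with ADDITIVE reduction at `p` and a minimal equation with
`p ∣ aᵢ` (`i = 1, 2, 3, 4, 6`), `E(ℚ_p)[p] ≠ 0` iff `p = 2 ∧ a₁ + a₃ ≡ 2 (4)`, or `p = 3 ∧ a₂ ≡ 6 (9)`,
or `p = 5 ∧ a₄ ≡ 10 (25)`, or `p = 7 ∧ a₆ ≡ 14 (49)` — quoting M. Kosters, R. Pannekoek,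
arXiv:1703.07888 [KostersPannekoek2017], Thm. 1 / Cor. 2 (`K = ℚ_p`); C.-H. Kim, K. Nakamura,
J. Number Theory 210 (2020) = arXiv:1808.07726 [KimNakamura2020], (2.1) and Assumption 2.5 (arXiv
p. 5); J. H. Silverman, *AEC* 2nd ed. [SilvermanAEC2009], VII.2.1 (`E₀ ⊇ E₁`, reduction), VII.3.1
with IV.6.1 (`E₁(ℚ_p)` has no `p`-torsion, `p ≥ 3`), Exercise 3.7 (`ψ₅`); J. H. Silverman, *ATAEC*
[SilvermanATAEC1994], Cor. IV.9.2(d) (Kodaira–Néron: `[E(K) : E₀(K)] ≤ 4` unless split multiplicative).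

`Proofs`-style file (THEOREMS ONLY: no definition, no named fact, no instance; D-0026 net debt 0),
sibling of `LocalTorsionAdditiveReductionPPrimaryProofs` (`#E(ℚ_p)[p^k] ≤ p` at an additive
`p ≥ 5`) and consumer of `KimNakamura2020/NonExceptionalFiveTorsionProofs` (the `E₀ ∖ E₁` clause at
`p = 5`, by the `5`-division polynomial). What is proved — the direction "not exceptional ⇒
`E(ℚ₅)[5] = 0`" of Kim's Prop. 3.2 / Kosters–Pannekoek's Cor. 2 at `p = 5`, in the kernel:

> for `W/ℚ` globally minimal elliptic whose coefficients are `aᵢ = 5cᵢ` (`cᵢ ∈ ℤ`; a model (2.1) of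
> Kim–Nakamura — then the reduction at `5` is additive) with `c₄ ≢ 2 (mod 5)` (`a₄ ≢ 10 (mod 25)`),
> every `Q ∈ W(ℚ₅)` with `5 • Q = O` is `O` (`eq_zero_of_five_nsmul_eq_zero_of_coeff_eq_five_mul`);
> and the same for ANY globally minimal elliptic `W/ℚ` admitting an integral translate
> `(x, y) ↦ (x + r, y + sx + t)`, `r, s, t ∈ ℤ`, onto such a model
> (`eq_zero_of_five_nsmul_eq_zero_of_translate`: five closed rational identities and one integer
> non-divisibility, `norm_num`/`decide` on a concrete curve).

Proof (Kim's §3.1 filtration argument, all from results the tree holds). Let `X = W ⊗ ℚ₅`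
(`ℤ₅`-minimal, `isMinimal_map_padic_of_isGloballyMinimal`). (a) `c₄(X) = b₂² − 24b₄ ∈ 5ℤ₅`, so `X`
is not multiplicative, and by Kodaira–Néron (`[X(ℚ₅) : X₀(ℚ₅)] ≤ 4 < 5`, tree
`hasSplitMultiplicativeReduction_of_not_mem_goodReductionSubgroup`) a point killed by `5` lies in
`X₀(ℚ₅)` (`WeierstrassCurve.goodReductionSubgroup`, membership = nonsingular reduction,
`mem_goodReductionSubgroup_iff_holds`). (b) If `Q = (x, y)` with `x ∉ ℤ₅` then `Q ∈ X₁(ℚ₅)`, which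
has no `5`-torsion (`eq_zero_of_isInReductionKernel_of_pow_nsmul`, *AEC* VII.3.1/IV.6.1). (c) Else
`x, y ∈ ℤ₅` and `(x̄, ȳ)` is a nonsingular point of the reduction `ȳ² = x̄³` (all `āᵢ = 0`), so
`x̄ ≠ 0`, `x ∈ ℤ₅ˣ`, and `5 • Q ≠ O` by `KimNakamura2020.five_nsmul_ne_zero_of_isUnit_five`
(`ψ₅(x) ≡ 5(1 + 2c₄) ≢ 0 (mod 25)`). The translate version transports along the tree's
`VariableChange.pointEquivBaseChange W C ℚ₅ : W(ℚ₅) ≃+ (C • W)(ℚ₅)`, after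
`isGloballyMinimal_smul_of_int`: an integral translate (`u = 1`, `r, s, t ∈ ℤ`) of a globally
minimal equation is globally minimal (same discriminant; tree `IsMinimal.smul_baseChange`).

## Statements
* §1 `isGloballyMinimal_smul_of_int` (global minimality is stable under `⟨1, r, s, t⟩`, `r, s, t ∈ ℤ`).
* §2 `eq_zero_of_five_nsmul_eq_zero_of_coeff_eq_five_mul` (the display, on the (2.1)-model),
  `eq_zero_of_five_nsmul_eq_zero_of_translate` (on any globally minimal `W` with an integral
  translate certificate).
USE (cell `pub/bsd-potss/`, Coates–Sujatha Conjecture A, tame additive rows at `p = 5`): the local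
clause "`E(K_v)[5] = 0` at the place `v ∣ 5`" of the decomposition-fixed / Selmer-trivial road
(`InertiaFixedTorsionAdditiveVanishingProofs.geomPrimaryTorsion_decomp_fixed_eq_zero_of_dvd_pow_mul_pow`
handles every place `v ∤ 5`) is, for a row whose (2.1)-model is certified non-exceptional, the
theorem `eq_zero_of_five_nsmul_eq_zero_of_translate` — no named fact is consumed. HONEST FRAMING:
the converse ("exceptional ⇒ `E₀(ℚ₅)[5] ≠ 0`") and the cases `p = 2, 3, 7` are not formalised here
(`p = 3`: `KimNakamura2020/NonExceptionalThreeTorsionProofs` has the `E₀ ∖ E₁` clause); nothing is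
booked by this file and no `Summits/` file is touched.

## References
* C.-H. Kim, Amer. J. Math. 148 (2026) = arXiv:2203.12159, §3.1 and Prop. 3.2 (PDF p. 15).
  [Kim2022StructureSelmer]
* M. Kosters, R. Pannekoek, arXiv:1703.07888, Thm. 1 and Cor. 2 (arXiv p. 3). [KostersPannekoek2017]
* C.-H. Kim, K. Nakamura, J. Number Theory 210 (2020) = arXiv:1808.07726, (2.1), Assumption 2.5
  (arXiv p. 5). [KimNakamura2020]
* J. H. Silverman, *The Arithmetic of Elliptic Curves*, 2nd ed., GTM 106 (2009), VII.2 Prop. 2.1,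
  VII.3 Prop. 3.1 (with IV.6 Thm. 6.1), VIII.8 (global minimal equations), Exercise 3.7. [SilvermanAEC2009]
* J. H. Silverman, *Advanced Topics in the Arithmetic of Elliptic Curves*, GTM 151 (1994),
  Cor. IV.9.2(d). [SilvermanATAEC1994]
-/

noncomputable section

open scoped Classical

open WeierstrassCurve IsDedekindDomain NumberField
  Literature.NumberTheory.EllipticCurves.KimNakamura2020

namespace Literature.NumberTheory.EllipticCurves

/-! ### §1 An integral translate of a globally minimal equation is globally minimal -/

/-- **Global minimality is stable under integral translates.** If `W/ℚ` is globally minimal and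
`r, s, t ∈ ℤ`, then `⟨1, r, s, t⟩ • W` — the equation in the coordinates `x = x' + r`,
`y = y' + sx' + t` — is globally minimal: it is integral (an `𝓞 ℚ`-integral change of an integral
equation) and, at every finite place `v`, an `𝓞_v`-integral change of variables preserves minimality
(same discriminant; tree `IsMinimal.smul_baseChange`). [cite: SilvermanAEC2009, VII.1 Prop. 1.3(b)
and VIII.8 (definition of a global minimal equation)] -/
theorem isGloballyMinimal_smul_of_int (W : WeierstrassCurve ℚ) [hW : W.IsGloballyMinimal]
    (r s t : ℤ) : ((⟨1, r, s, t⟩ : VariableChange ℚ) • W).IsGloballyMinimal := by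
  refine ⟨?_, fun v => ?_⟩
  · -- integrality over `𝓞 ℚ`
    obtain ⟨W₀, hW₀⟩ := hW.isIntegral.integral
    refine ⟨⟨(⟨1, r, s, t⟩ : VariableChange (𝓞 ℚ)) • W₀, ?_⟩⟩
    rw [hW₀]
    simp only [WeierstrassCurve.baseChange]
    rw [← map_variableChange]
    congr 1
  · -- minimality at `v`: an `𝓞_v`-integral change of variables
    haveI := hW.isMinimal v
    have h := IsMinimal.smul_baseChange (W.baseChange (v.adicCompletion ℚ))
      (⟨1, r, s, t⟩ : VariableChange (v.adicCompletionIntegers ℚ))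
    have hC : (⟨1, r, s, t⟩ : VariableChange (v.adicCompletionIntegers ℚ)).baseChange
        (v.adicCompletion ℚ) =
          ((⟨1, r, s, t⟩ : VariableChange ℚ).map (algebraMap ℚ (v.adicCompletion ℚ))) := by
      ext <;> simp [VariableChange.baseChange, VariableChange.map]
    rw [hC, ← VariableChange.baseChange_smul_eq] at h
    exact h

/-! ### §2 `E(ℚ₅)[5] = 0` on a non-exceptional (2.1)-model, and through an integral translate -/

/-- The reduction of a `ℤ₅`-minimal equation over `ℚ₅` all of whose coefficients lie in `5ℤ` is the
cuspidal cubic `ȳ² = x̄³`: all `āᵢ = 0`; private plumbing (Mathlib's `reduction` is the chosen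
integral model — here the equation itself, `algebraMap ℤ₅ ℚ₅` being injective — read modulo `5`).
[folklore] -/
private theorem reduction_a_eq_zero (X : WeierstrassCurve ℚ_[5]) [X.IsMinimal ℤ_[5]]
    {c₁ c₂ c₃ c₄ c₆ : ℤ} (h₁ : X.a₁ = 5 * c₁) (h₂ : X.a₂ = 5 * c₂) (h₃ : X.a₃ = 5 * c₃)
    (h₄ : X.a₄ = 5 * c₄) (h₆ : X.a₆ = 5 * c₆) :
    (X.reduction ℤ_[5]).a₁ = 0 ∧ (X.reduction ℤ_[5]).a₂ = 0 ∧ (X.reduction ℤ_[5]).a₃ = 0 ∧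
      (X.reduction ℤ_[5]).a₄ = 0 ∧ (X.reduction ℤ_[5]).a₆ = 0 := by
  have key : ∀ (a : ℤ_[5]) (c : ℤ), algebraMap ℤ_[5] ℚ_[5] a = 5 * c →
      IsLocalRing.residue ℤ_[5] a = 0 := by
    intro a c ha
    have hac : a = ((5 * c : ℤ) : ℤ_[5]) := by
      apply PadicInt.ext
      rw [PadicInt.algebraMap_apply] at ha
      rw [ha]
      push_cast
      rfl
    rw [hac, IsLocalRing.residue_eq_zero_iff, PadicInt.maximalIdeal_eq_span_p,
      Ideal.mem_span_singleton]
    exact ⟨c, by push_cast; ring⟩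
  simp only [WeierstrassCurve.reduction, map_a₁, map_a₂, map_a₃, map_a₄, map_a₆]
  exact ⟨key _ c₁ (by rw [integralModel_a₁_eq, h₁]), key _ c₂ (by rw [integralModel_a₂_eq, h₂]),
    key _ c₃ (by rw [integralModel_a₃_eq, h₃]), key _ c₄ (by rw [integralModel_a₄_eq, h₄]),
    key _ c₆ (by rw [integralModel_a₆_eq, h₆])⟩

/-- **Kim 2026 Prop. 3.2 / Kosters–Pannekoek Cor. 2 at `p = 5`, direction "not exceptional ⇒
`E(ℚ₅)[5] = 0`", on a globally minimal (2.1)-model.** Let `W/ℚ` be a globally minimal elliptic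
curve with `aᵢ = 5cᵢ`, `cᵢ ∈ ℤ` (so the reduction at `5` is additive) and `c₄ ≢ 2 (mod 5)`
(`a₄ ≢ 10 (mod 25)`). Then every `Q ∈ W(ℚ₅)` with `5 • Q = O` is `O`. Proof: (a) `c₄(W) ∈ 5ℤ`, so
`W ⊗ ℚ₅` is not multiplicative and Kodaira–Néron puts `Q` in `E₀(ℚ₅)`
(`hasSplitMultiplicativeReduction_of_not_mem_goodReductionSubgroup`); (b) a point of `E₁(ℚ₅)` killed
by `5` is `O` (`eq_zero_of_isInReductionKernel_of_pow_nsmul`); (c) a point of `E₀ ∖ E₁` has `x ∈ ℤ₅ˣ`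
(the reduction `ȳ² = x̄³` is singular at `(0,0)`), and then `5 • Q ≠ O`
(`KimNakamura2020.five_nsmul_ne_zero_of_isUnit_five`, the `5`-division polynomial mod `25`).
[cite: Kim2022StructureSelmer, §3.1 and Prop. 3.2 (PDF p. 15)] [cite: KostersPannekoek2017, Cor. 2]
[cite: SilvermanAEC2009, VII.2 Prop. 2.1, VII.3 Prop. 3.1 (with IV.6 Thm. 6.1), Exercise 3.7]
[cite: SilvermanATAEC1994, Cor. IV.9.2(d) (PDF p. 340)] -/
theorem eq_zero_of_five_nsmul_eq_zero_of_coeff_eq_five_mul (W : WeierstrassCurve ℚ) [W.IsElliptic]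
    [W.IsGloballyMinimal] {c₁ c₂ c₃ c₄ c₆ : ℤ} (h₁ : W.a₁ = 5 * c₁) (h₂ : W.a₂ = 5 * c₂)
    (h₃ : W.a₃ = 5 * c₃) (h₄ : W.a₄ = 5 * c₄) (h₆ : W.a₆ = 5 * c₆) (hc₄ : ¬ (5 : ℤ) ∣ c₄ - 2)
    (Q : (W.baseChange ℚ_[5]).toAffine.Point) (hQ : 5 • Q = 0) : Q = 0 := by
  -- `X = W ⊗ ℚ₅` is `ℤ₅`-minimal and elliptic; the residue field `𝔽₅` is finite (perfect)
  haveI : (W.baseChange ℚ_[5]).IsMinimal ℤ_[5] := isMinimal_map_padic_of_isGloballyMinimal W 5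
  haveI : (W.baseChange ℚ_[5]).IsElliptic := by rw [WeierstrassCurve.baseChange]; infer_instance
  haveI := finite_residueField_padicInt 5
  -- the coefficients of `X`
  have hX₁ : (W.baseChange ℚ_[5]).a₁ = 5 * (c₁ : ℚ_[5]) := by simp [WeierstrassCurve.baseChange, h₁]
  have hX₂ : (W.baseChange ℚ_[5]).a₂ = 5 * (c₂ : ℚ_[5]) := by simp [WeierstrassCurve.baseChange, h₂]
  have hX₃ : (W.baseChange ℚ_[5]).a₃ = 5 * (c₃ : ℚ_[5]) := by simp [WeierstrassCurve.baseChange, h₃]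
  have hX₄ : (W.baseChange ℚ_[5]).a₄ = 5 * (c₄ : ℚ_[5]) := by simp [WeierstrassCurve.baseChange, h₄]
  have hX₆ : (W.baseChange ℚ_[5]).a₆ = 5 * (c₆ : ℚ_[5]) := by simp [WeierstrassCurve.baseChange, h₆]
  -- (a) `X` is not multiplicative: `c₄ = 5·m`, `m ∈ ℤ`
  have hc4 : (W.baseChange ℚ_[5]).c₄ = algebraMap ℤ_[5] ℚ_[5]
      ((5 * (5 * (5 * c₁ ^ 2 + 4 * c₂) ^ 2 - 24 * (2 * c₄ + 5 * c₁ * c₃)) : ℤ) : ℤ_[5]) := by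
    rw [PadicInt.algebraMap_apply, PadicInt.coe_intCast]
    simp only [WeierstrassCurve.c₄, WeierstrassCurve.b₂, WeierstrassCurve.b₄, hX₁, hX₂, hX₃, hX₄]
    push_cast
    ring
  have hnm : ¬ (W.baseChange ℚ_[5]).HasMultiplicativeReduction ℤ_[5] := by
    intro hm
    have h1 := hm.multiplicativeReduction
    rw [hc4] at h1
    have hlt : IsDedekindDomain.HeightOneSpectrum.valuation ℚ_[5]
        (IsDiscreteValuationRing.maximalIdeal ℤ_[5]) (algebraMap ℤ_[5] ℚ_[5]
          ((5 * (5 * (5 * c₁ ^ 2 + 4 * c₂) ^ 2 - 24 * (2 * c₄ + 5 * c₁ * c₃)) : ℤ) : ℤ_[5])) < 1 := by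
      rw [IsDedekindDomain.HeightOneSpectrum.valuation_lt_one_iff_mem]
      change _ ∈ IsLocalRing.maximalIdeal ℤ_[5]
      rw [PadicInt.maximalIdeal_eq_span_p, Ideal.mem_span_singleton]
      exact ⟨((5 * (5 * c₁ ^ 2 + 4 * c₂) ^ 2 - 24 * (2 * c₄ + 5 * c₁ * c₃) : ℤ) : ℤ_[5]),
        by push_cast; ring⟩
    exact (ne_of_lt hlt) h1
  -- hence `Q ∈ E₀(ℚ₅)` (Kodaira–Néron: the index is `≤ 4 < 5`)
  have hQ₀ : Q ∈ (W.baseChange ℚ_[5]).goodReductionSubgroup ℤ_[5] := by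
    by_contra hQn
    exact hnm (hasSplitMultiplicativeReduction_of_not_mem_goodReductionSubgroup ℤ_[5]
      (W.baseChange ℚ_[5]) Nat.prime_five le_rfl hQ hQn).1.toHasMultiplicativeReduction
  have hns :=
    (WeierstrassCurve.mem_goodReductionSubgroup_iff_holds ℤ_[5] (W.baseChange ℚ_[5]) Q).mp hQ₀
  -- (b)/(c) case analysis on the reduction of `Q`
  rcases Q with _ | ⟨x, y, hxy⟩
  · rfl
  rcases hns with hx | ⟨x₀, y₀, hx₀, hy₀, hred⟩
  · -- `Q ∈ E₁(ℚ₅)`, which has no `5`-torsion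
    have hker : (W.baseChange ℚ_[5]).IsInReductionKernel (.some x y hxy) := by
      rw [WeierstrassCurve.isInReductionKernel_some]
      by_contra hle
      exact hx ⟨⟨x, not_lt.mp hle⟩, rfl⟩
    exact eq_zero_of_isInReductionKernel_of_pow_nsmul W 5 (by norm_num) 1 _ hker
      (by rw [pow_one]; exact hQ)
  · -- `Q ∈ E₀ ∖ E₁`: `x = x₀ ∈ ℤ₅`, and the reduction `ȳ² = x̄³` is nonsingular at `(x̄₀, ȳ₀)`
    exfalso
    obtain ⟨ha₁, ha₂, ha₃, ha₄, ha₆⟩ := reduction_a_eq_zero (W.baseChange ℚ_[5]) hX₁ hX₂ hX₃ hX₄ hX₆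
    have hx0 : IsUnit x₀ := by
      by_contra hxu
      have hxz : IsLocalRing.residue ℤ_[5] x₀ = 0 :=
        (IsLocalRing.residue_eq_zero_iff _).mpr ((IsLocalRing.mem_maximalIdeal _).mpr hxu)
      obtain ⟨heq, hor⟩ := (WeierstrassCurve.Affine.nonsingular_iff _ _).mp hred
      rw [WeierstrassCurve.Affine.equation_iff] at heq
      simp only [ha₁, ha₂, ha₃, ha₄, ha₆, hxz] at heq hor
      have hyz : IsLocalRing.residue ℤ_[5] y₀ = 0 := by simpa using heq
      simp [hyz] at hor
    rw [PadicInt.algebraMap_apply] at hx₀ hy₀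
    subst hx₀ hy₀
    exact five_nsmul_ne_zero_of_isUnit_five (W.baseChange ℚ_[5]) hX₁ hX₂ hX₃ hX₄ hX₆ hc₄ hx0 hxy hQ

/-- **`E(ℚ₅)[5] = 0` for any globally minimal `W/ℚ` with a non-exceptional integral (2.1)-translate.**
Let `W/ℚ` be globally minimal elliptic and `r, s, t, cᵢ ∈ ℤ` with — Mathlib's `variableChange_aᵢ`
formulas for `⟨1, r, s, t⟩` — `a₁ + 2s = 5c₁`, `a₂ − s a₁ + 3r − s² = 5c₂`, `a₃ + r a₁ + 2t = 5c₃`,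
`a₄ − s a₃ + 2r a₂ − (t + rs) a₁ + 3r² − 2st = 5c₄`,
`a₆ + r a₄ + r² a₂ + r³ − t a₃ − t² − rt a₁ = 5c₆`, and `5 ∤ c₄ − 2`. Then every `Q ∈ W(ℚ₅)` with
`5 • Q = O` is `O`: transport along `VariableChange.pointEquivBaseChange W ⟨1, r, s, t⟩ ℚ₅` to the
translate, which is globally minimal (`isGloballyMinimal_smul_of_int`) with `aᵢ = 5cᵢ`, and apply
`eq_zero_of_five_nsmul_eq_zero_of_coeff_eq_five_mul`. Each hypothesis is a closed rational identity
resp. an integer non-divisibility (`norm_num` / `decide` on a concrete curve).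
[cite: Kim2022StructureSelmer, Prop. 3.2 (PDF p. 15)] [cite: KostersPannekoek2017, Cor. 2]
[cite: KimNakamura2020, (2.1) and Assumption 2.5 (arXiv p. 5)] -/
theorem eq_zero_of_five_nsmul_eq_zero_of_translate (W : WeierstrassCurve ℚ) [W.IsElliptic]
    [W.IsGloballyMinimal] (r s t c₁ c₂ c₃ c₄ c₆ : ℤ)
    (h₁ : W.a₁ + 2 * s = 5 * c₁)
    (h₂ : W.a₂ - s * W.a₁ + 3 * r - s ^ 2 = 5 * c₂)
    (h₃ : W.a₃ + r * W.a₁ + 2 * t = 5 * c₃)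
    (h₄ : W.a₄ - s * W.a₃ + 2 * r * W.a₂ - (t + r * s) * W.a₁ + 3 * r ^ 2 - 2 * s * t = 5 * c₄)
    (h₆ : W.a₆ + r * W.a₄ + r ^ 2 * W.a₂ + r ^ 3 - t * W.a₃ - t ^ 2 - r * t * W.a₁ = 5 * c₆)
    (hc₄ : ¬ (5 : ℤ) ∣ c₄ - 2)
    (Q : (W.baseChange ℚ_[5]).toAffine.Point) (hQ : 5 • Q = 0) : Q = 0 := by
  set C : VariableChange ℚ := ⟨1, r, s, t⟩ with hC
  haveI : (C • W).IsGloballyMinimal := isGloballyMinimal_smul_of_int W r s t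
  have e₁ : (C • W).a₁ = 5 * c₁ := by
    rw [hC, WeierstrassCurve.variableChange_a₁, ← h₁]; simp
  have e₂ : (C • W).a₂ = 5 * c₂ := by
    rw [hC, WeierstrassCurve.variableChange_a₂, ← h₂]; simp
  have e₃ : (C • W).a₃ = 5 * c₃ := by
    rw [hC, WeierstrassCurve.variableChange_a₃, ← h₃]; simp
  have e₄ : (C • W).a₄ = 5 * c₄ := by
    rw [hC, WeierstrassCurve.variableChange_a₄, ← h₄]; simp
  have e₆ : (C • W).a₆ = 5 * c₆ := by
    rw [hC, WeierstrassCurve.variableChange_a₆, ← h₆]; simp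
  set φ := VariableChange.pointEquivBaseChange W C ℚ_[5] with hφ
  have hQ' : 5 • φ Q = 0 := by rw [← map_nsmul, hQ, map_zero]
  have h0 : φ Q = 0 :=
    eq_zero_of_five_nsmul_eq_zero_of_coeff_eq_five_mul (C • W) e₁ e₂ e₃ e₄ e₆ hc₄ (φ Q) hQ'
  exact φ.injective (by rw [h0, map_zero])

end Literature.NumberTheory.EllipticCurves

end
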